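import Summits.BirchSwinnertonDyer.BirchSwinnertonDyer.Theorems.SylvesterTwoHeegnerIndexUpperOffV0PropNineOne
import Literature.NumberTheory.EllipticCurves.VariableChangePointsMap
import HarnessLib

/-!
# K7t crux `UpperOffV0HSY` (item 19581): McCallum's Prop. 3.1 / Cor. 3.2 Step B at `p = 2` —
# the Galois element with prescribed local orders, for the CM curves `y² = x³ − c`

Route `SylvesterTwoHeegnerIndex` (cell bsd-cm, rung K7t).  The tree's Step B
(`IsLiftOfAut.exists_h1Eval_conj_mul_order`, McCallum 1991 §3, PDF p. 280: *"choose `φ ∈ C^*` such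
that `ord φ(c_i) = p^{N_i}` … `Frob(λ') = (τρ)² = ρ^τ·ρ`"*) ends with `[x_i, ρ^τρ] = 2[x_i, ρ]` for a
`ν_i`-eigenvector `[x_i, ρ]` and needs `2 ∈ (ℤ/p^M)ˣ` — fatal at `p = 2`.  For an `ℚ`-model `W` of
`y² = x³ − c` over a number field `K` with `∛c ∉ K`, `ω ∉ K`, and an involutive lift `τ` of
`σ ∈ Aut(K/ℚ)` with `τ(ω) = ω²` (complex conjugation), this file proves Step B at level `2^M`:

* §1 `map_omegaRot_of_map_omega_eq_sq` — a `ℚ`-algebra endomorphism `f` of `K̄` with `f(ω) = ω²`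
  is `[ω]`-SEMILINEAR on `E(K̄)`; `exists_omega_semilinear_lift` — `[ω]` on `E_W(K̄)` (transported
  from the Mordell model `C • W` along `VariableChange.pointEquivBaseChange`) with `[ω]² + [ω] + 1 = 0`
  and `τ[ω] = [ω]²τ` for the tree's `IsLiftOfAut.pointsMap`;
* §2 `exists_h1Eval_conj_mul_order_two` — **Step B at `2`**: for independent `σ`-eigenclasses
  `x_i ∈ H¹(K, E[2^M])` (`conjAct W σ (2^M) x_i = ν_i x_i`) and `N_i ≤ min(e_i, M)` there is
  `ρ ∈ Γ_{K(E[2^M])}` with `ord [x_i, (ρm)^τ(ρm)] = 2^{N_i}` EXACTLY for all `m ∈ 𝒩`.  The values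
  `[x_i, ρ] = ∓2^{M−N_i}[ω]P` are prescribed by McCallum's (2) at `2`
  (`exists_h1Eval_eq_of_indep_twoPow`), and `[x_i, ρ^τρ] = (1 + ν_iτ)[x_i, ρ] = 2^{M−N_i}·P` resp.
  `2^{M−N_i}·(P + 2[ω]P)` by the SURJECTIVITY of `1 ± τ` onto the eigenlines
  (`EisensteinTorsion.exists_add_tau_eq` / `exists_sub_tau_eq`) — no division by `2`; `P` is a
  `τ`-fixed generator of order `2^M` (`exists_tau_fixed_addOrderOf_eq`).

With the tree's p-independent Čebotarev step `exists_kolyvaginPrime_gt_of_galoisElement` this is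
McCallum's Cor. 3.2 at `p = 2` for `E_p` (not assembled here).  NOT the crux: the sharp 2-adic bound
off 𝒱₀ stays open (B14 = O12 open as a class).
-/

noncomputable section

open scoped Classical
open Field WeierstrassCurve Literature.NumberTheory.EllipticCurves
  Literature.NumberTheory.GaloisRepresentations

set_option autoImplicit false
set_option linter.dupNamespace false

namespace Summit.BirchSwinnertonDyer.BirchSwinnertonDyer.Theorems.SylvesterTwoUpper

universe u

/-! ## §1 `[ω]` and a semilinear lift -/

section Semilinear

variable {F : Type*} [Field F] {V : WeierstrassCurve F} {L : Type*} [Field L] [Algebra F L]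
  {ω : L} (hω : ω ^ 2 + ω + 1 = 0)
  {θ : (V.baseChange L).toAffine.Point → (V.baseChange L).toAffine.Point} (hθ0 : θ 0 = 0)
  (hns : ∀ {x y : L}, (V.baseChange L).toAffine.Nonsingular x y →
    (V.baseChange L).toAffine.Nonsingular (ω * x) y)
  (hθ : ∀ (x y : L) (h : (V.baseChange L).toAffine.Nonsingular x y),
    θ (.some x y h) = .some (ω * x) y (hns h))

include hθ0 hθ

omit hω in
/-- An `F`-algebra endomorphism of `L` fixing `ω` COMMUTES with `[ω] : (x, y) ↦ (ωx, y)`. [folklore] -/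
theorem map_omegaRot_of_map_omega_eq (f : L →ₐ[F] L) (hf : f ω = ω)
    (P : (V.baseChange L).toAffine.Point) :
    Affine.Point.map (W' := V) f (θ P) = θ (Affine.Point.map (W' := V) f P) := by
  rcases P with _ | ⟨x, y, h⟩
  · rw [← Affine.Point.zero_def, hθ0, map_zero, hθ0]
  · rw [hθ x y h, Affine.Point.map_some, Affine.Point.map_some, hθ]
    exact Affine.Point.some_eq_some_of_eq (by rw [map_mul, hf]) rfl

omit hω in
/-- An `F`-algebra endomorphism `f` of `L` with `f(ω) = ω²` is `[ω]`-SEMILINEAR: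
`f([ω]P) = [ω]([ω](f P))`. [folklore] -/
theorem map_omegaRot_of_map_omega_eq_sq (f : L →ₐ[F] L) (hf : f ω = ω ^ 2)
    (P : (V.baseChange L).toAffine.Point) :
    Affine.Point.map (W' := V) f (θ P) = θ (θ (Affine.Point.map (W' := V) f P)) := by
  rcases P with _ | ⟨x, y, h⟩
  · rw [← Affine.Point.zero_def, hθ0, map_zero, hθ0, hθ0]
  · rw [hθ x y h, Affine.Point.map_some, Affine.Point.map_some, hθ, hθ]
    exact Affine.Point.some_eq_some_of_eq (by rw [map_mul, hf, pow_two, mul_assoc]) rfl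

end Semilinear

section Lift

variable {K : Type u} [Field K] [CharZero K] (W : WeierstrassCurve ℚ) [W.IsElliptic]
  {σ : K ≃ₐ[ℚ] K} {τ : AlgebraicClosure K ≃+* AlgebraicClosure K}

omit [W.IsElliptic] in
/-- **`[ω]` on `E_W(K̄)` for a `ℚ`-model `W` of a Mordell curve, semilinear for a lift `τ` of
`σ ∈ Aut(K/ℚ)` with `τ(ω) = ω²`**: an additive `θ` on `geomPoints (W ×_ℚ K)` with `θ² + θ + 1 = 0`
and `τ(θP) = θ(θ(τP))` for the tree's `IsLiftOfAut.pointsMap` (x1b's `exists_omegaRot` on the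
Mordell model `C • W` over `K̄`, transported along `VariableChange.pointEquivBaseChange W C K̄`, which
commutes with every `ℚ`-algebra map of `K̄`).
[cite: HuShuYin2019, p. 4 (the complex multiplication `[ω](x,y) = (ωx, y)`)] -/
theorem exists_omega_semilinear_lift {C : VariableChange ℚ} {c : ℚ} (hCW : C • W = ⟨0, 0, 0, 0, -c⟩)
    (hτ : IsLiftOfAut σ τ) {ω : AlgebraicClosure K} (hω : ω ^ 2 + ω + 1 = 0) (hτω : τ ω = ω ^ 2) :
    ∃ θ : geomPoints (W.baseChange K) →+ geomPoints (W.baseChange K),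
      (∀ P, θ (θ P) + θ P + P = 0) ∧ ∀ P, hτ.pointsMap W (θ P) = θ (θ (hτ.pointsMap W P)) := by
  have h1 : ((C • W).baseChange (AlgebraicClosure K)).a₁ = 0 := by
    rw [hCW]; simp [WeierstrassCurve.baseChange]
  have h2 : ((C • W).baseChange (AlgebraicClosure K)).a₂ = 0 := by
    rw [hCW]; simp [WeierstrassCurve.baseChange]
  have h3 : ((C • W).baseChange (AlgebraicClosure K)).a₃ = 0 := by
    rw [hCW]; simp [WeierstrassCurve.baseChange]
  have h4 : ((C • W).baseChange (AlgebraicClosure K)).a₄ = 0 := by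
    rw [hCW]; simp [WeierstrassCurve.baseChange]
  obtain ⟨θ₁, hθ₁⟩ := SylvesterTwoCMNormForm.exists_omegaRot hω h1 h2 h3 h4
  have hω1 : ω ≠ 1 := fun h => by
    rw [h] at hω
    norm_num at hω
  have hrel₁ : ∀ Q, θ₁ (θ₁ Q) + θ₁ Q + Q = 0 := fun Q =>
    SylvesterTwoCMNormForm.omegaRot_omegaRot_add_omegaRot_add hω h1 h2 h3 h4 (θ := θ₁)
      (map_zero θ₁) hθ₁ hω1 Q
  let f : AlgebraicClosure K →ₐ[ℚ] AlgebraicClosure K :=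
    (hτ.algEquiv : AlgebraicClosure K ≃ₐ[ℚ] AlgebraicClosure K).toAlgHom
  have hfω : f ω = ω ^ 2 := by rw [← hτω]; rfl
  have hpm : ∀ Q : geomPoints (W.baseChange K), hτ.pointsMap W Q = Affine.Point.map (W' := W) f Q :=
    fun Q => rfl
  have hsemi₁ : ∀ Q : ((C • W).baseChange (AlgebraicClosure K)).toAffine.Point,
      Affine.Point.map (W' := C • W) f (θ₁ Q) = θ₁ (θ₁ (Affine.Point.map (W' := C • W) f Q)) :=
    fun Q => map_omegaRot_of_map_omega_eq_sq (V := C • W) (θ := θ₁) (map_zero θ₁)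
      (fun h => SylvesterTwoCMNormForm.nonsingular_omega_mul hω h1 h2 h3 h4 h) hθ₁ f hfω Q
  let e : geomPoints (W.baseChange K) ≃+ ((C • W).baseChange (AlgebraicClosure K)).toAffine.Point :=
    VariableChange.pointEquivBaseChange W C (AlgebraicClosure K)
  have hnat : ∀ Q : geomPoints (W.baseChange K),
      e (hτ.pointsMap W Q) = Affine.Point.map (W' := C • W) f (e Q) := fun Q => by
    rw [hpm]
    exact (VariableChange.pointEquivBaseChange_map W C f Q).symm
  have hnat' : ∀ R, e.symm (Affine.Point.map (W' := C • W) f R) = hτ.pointsMap W (e.symm R) :=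
    fun R => by
    apply e.injective
    rw [hnat, e.apply_symm_apply, e.apply_symm_apply]
  refine ⟨e.symm.toAddMonoidHom.comp (θ₁.toAddMonoidHom.comp e.toAddMonoidHom), fun P => ?_,
    fun P => ?_⟩
  · change e.symm (θ₁ (e (e.symm (θ₁ (e P))))) + e.symm (θ₁ (e P)) + P = 0
    rw [e.apply_symm_apply]
    have h' := congrArg e.symm (hrel₁ (e P))
    rwa [map_add, map_add, map_zero, e.symm_apply_apply] at h'
  · change hτ.pointsMap W (e.symm (θ₁ (e P))) = e.symm (θ₁ (e (e.symm (θ₁ (e (hτ.pointsMap W P))))))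
    rw [e.apply_symm_apply, ← hnat', hsemi₁, hnat]

end Lift

/-! ## §2 Step B at `p = 2` -/

section StepB

variable {K : Type u} [Field K] [NumberField K] (W : WeierstrassCurve ℚ) [W.IsElliptic]
  {σ : K ≃ₐ[ℚ] K} {τ : AlgebraicClosure K ≃+* AlgebraicClosure K}

/-- **McCallum's Prop. 3.1 / Cor. 3.2, Step B, at `p = 2`** for a `ℚ`-model `W` of `y² = x³ − c`
over a number field `K` with `∛c ∉ K` and `ω ∉ K`, an involutive lift `τ` of `σ ∈ Aut(K/ℚ)` with
`τ(ω) = ω²`, and level `n = 2^M` (`M ≥ 1`): for `σ`-eigenclasses `x_i ∈ H¹(K, E[2^M])`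
(`conjAct W σ n x_i = ν_i x_i`) killed by `2^{e_i}` and independent, and `N_i ≤ min(e_i, M)`, there
is `ρ ∈ Γ_{K(E[2^M])}` with `2^{N_i}[x_i, (ρm)^τ(ρm)] = 0` and `2^{N_i−1}[x_i, (ρm)^τ(ρm)] ≠ 0`
(`N_i ≠ 0`) for every `m ∈ 𝒩`.  The tree's `IsLiftOfAut.exists_h1Eval_conj_mul_order` with its
four `p`-odd inputs replaced at `2`: Prop. 9.1 (`eq_zero_of_h1Eval_eq_zero_twoPow`), `hS`/`hC`
(`…ModTwoImage`), eigenvectors (`exists_tau_fixed_addOrderOf_eq`), and the halving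
`[x, ρ^τρ] = 2[x, ρ]` by `(1 ± τ)E[2^M] = E[2^M]^±`. [cite: McCallumLMS1991, §3 Prop. 3.1 and Cor. 3.2 (proof)] -/
theorem exists_h1Eval_conj_mul_order_two {C : VariableChange ℚ} {c : ℚ}
    (hCW : C • W = ⟨0, 0, 0, 0, -c⟩) (hc : ∀ x : K, x ^ 3 ≠ (c : K))
    (hωK : ∀ x : K, x ^ 2 + x + 1 ≠ 0)
    (hτ : IsLiftOfAut σ τ) (hinv : ∀ x, τ (τ x) = x)
    {ω : AlgebraicClosure K} (hω : ω ^ 2 + ω + 1 = 0) (hτω : τ ω = ω ^ 2)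
    {M : ℕ} (hM : 1 ≤ M)
    {ι : Type*} [Fintype ι] {xs : ι → galH1Torsion (W.baseChange K) ((2 ^ M : ℕ) : ℤ)} {ν : ι → ℤ}
    (hν : ∀ i, ν i = 1 ∨ ν i = -1) (hxs : ∀ i, conjAct W σ ((2 ^ M : ℕ) : ℤ) (xs i) = ν i • xs i)
    (e : ι → ℕ) (he : ∀ i, ((2 : ℤ) ^ e i) • xs i = 0)
    (hind : ∀ a : ι → ℤ, ∑ i, a i • xs i = 0 → ∀ i, ((2 : ℤ) ^ e i) ∣ a i)
    (Nv : ι → ℕ) (hNe : ∀ i, Nv i ≤ e i) (hNM : ∀ i, Nv i ≤ M) :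
    ∃ ρ ∈ torsionFixing (W.baseChange K) ((2 ^ M : ℕ) : ℤ),
      ∀ m ∈ evalKer (W.baseChange K) ((2 ^ M : ℕ) : ℤ) xs, ∀ i,
      ((2 : ℤ) ^ Nv i) • h1Eval (W.baseChange K) ((2 ^ M : ℕ) : ℤ) (xs i)
          (hτ.conjGalCMH (ρ * m) * (ρ * m)) = 0 ∧
      (Nv i ≠ 0 → ((2 : ℤ) ^ (Nv i - 1)) • h1Eval (W.baseChange K) ((2 ^ M : ℕ) : ℤ) (xs i)
          (hτ.conjGalCMH (ρ * m) * (ρ * m)) ≠ 0) := by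
  -- the `K`-model `B = W ×_ℚ K` of the Mordell curve
  have hCB : (C.map (algebraMap ℚ K)) • W.baseChange K = ⟨0, 0, 0, 0, -(c : K)⟩ := by
    rw [← VariableChange.baseChange_smul_eq, hCW]
    ext <;> simp [WeierstrassCurve.baseChange]
  -- `[ω]` on `E[2^M]`, semilinear for `τ`
  obtain ⟨θ, hθrel, hθτ⟩ := exists_omega_semilinear_lift W hCW hτ hω hτω
  haveI : Finite (geomTorsion (W.baseChange K) ((2 ^ M : ℕ) : ℤ)) :=
    (W.baseChange K).finite_geomTorsion_nat (pow_ne_zero M two_ne_zero)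
  have hmem : ∀ Q : geomPoints (W.baseChange K),
      Q ∈ geomTorsion (W.baseChange K) ((2 ^ M : ℕ) : ℤ) ↔ ((2 ^ M : ℕ) : ℤ) • Q = 0 := fun Q =>
    Submodule.mem_torsionBy_iff _ Q
  have hθmem : ∀ T : geomTorsion (W.baseChange K) ((2 ^ M : ℕ) : ℤ),
      θ (T : geomPoints (W.baseChange K)) ∈ geomTorsion (W.baseChange K) ((2 ^ M : ℕ) : ℤ) := by
    intro T
    rw [hmem, ← map_zsmul, (hmem _).mp T.2, map_zero]
  let θN : geomTorsion (W.baseChange K) ((2 ^ M : ℕ) : ℤ) →+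
      geomTorsion (W.baseChange K) ((2 ^ M : ℕ) : ℤ) :=
    { toFun := fun T => ⟨θ T, hθmem T⟩
      map_zero' := Subtype.ext (by
        change θ ((0 : geomTorsion (W.baseChange K) ((2 ^ M : ℕ) : ℤ)) : geomPoints (W.baseChange K))
          = (0 : geomPoints (W.baseChange K))
        rw [ZeroMemClass.coe_zero, map_zero])
      map_add' := fun T T' => Subtype.ext (by
        change θ ((T + T' : geomTorsion (W.baseChange K) ((2 ^ M : ℕ) : ℤ)) :
          geomPoints (W.baseChange K)) = θ T + θ T'
        rw [AddMemClass.coe_add, map_add]) }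
  have hθN : ∀ T, θN (θN T) + θN T + T = 0 := fun T => Subtype.ext (hθrel T)
  have hτθ : ∀ T, hτ.torsionMap W ((2 ^ M : ℕ) : ℤ) (θN T) =
      θN (θN (hτ.torsionMap W ((2 ^ M : ℕ) : ℤ) T)) := fun T => Subtype.ext (hθτ T)
  have hτ2 : ∀ T, hτ.torsionMap W ((2 ^ M : ℕ) : ℤ) (hτ.torsionMap W ((2 ^ M : ℕ) : ℤ) T) = T :=
    fun T => hτ.torsionMap_torsionMap W hinv _ T
  -- order `4^M`, a point of order `2^M`, a `τ`-fixed generator `P`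
  have hmK : ((2 ^ M : ℕ) : K) ≠ 0 := by exact_mod_cast pow_ne_zero M (two_ne_zero (α := K))
  obtain ⟨P₀, hP₀⟩ := WeierstrassCurve.exists_addOrderOf_eq (W := W.baseChange K) hmK
  have hcard : Nat.card (geomTorsion (W.baseChange K) ((2 ^ M : ℕ) : ℤ)) = 4 ^ M := by
    rw [card_geomTorsion_two_pow (W.baseChange K) two_ne_zero M, pow_mul]
    norm_num
  obtain ⟨P, hτP, hP⟩ := EisensteinTorsion.exists_tau_fixed_addOrderOf_eq θN hθN
    (hτ.torsionMap W ((2 ^ M : ℕ) : ℤ)) hτθ hcard hP₀ hτ2 hM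
  have hkill : ∀ T : geomTorsion (W.baseChange K) ((2 ^ M : ℕ) : ℤ), ((2 : ℤ) ^ M) • T = 0 :=
    fun T => by
    have := EisensteinTorsion.pow_mul_zsmul_eq_zero θN hθN hcard hP 1 T
    rwa [mul_one] at this
  -- the generator `Q = P + 2θP` of the `(-1)`-eigenline also has order `2^M`
  have hQ : addOrderOf (P + (2 : ℤ) • θN P) = 2 ^ M := by
    have e1 : P + (2 : ℤ) • θN P = (1 : ℤ) • P + (2 : ℤ) • θN P := by rw [one_zsmul]
    rw [e1]
    exact EisensteinTorsion.addOrderOf_lin_eq_two_pow θN hθN hcard hP hM (by omega)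
  -- prescribed values `v_i = s_i • θP`, `s_i = ∓2^{M-N_i}`
  let s : ι → ℤ := fun i => if ν i = 1 then -(2 : ℤ) ^ (M - Nv i) else (2 : ℤ) ^ (M - Nv i)
  let v : ι → geomTorsion (W.baseChange K) ((2 ^ M : ℕ) : ℤ) := fun i => s i • θN P
  have hvkill : ∀ i, ((2 : ℤ) ^ e i) • v i = 0 := fun i => by
    have hpow : (2 : ℤ) ^ e i * (2 : ℤ) ^ (M - Nv i) = (2 : ℤ) ^ (e i - Nv i) * (2 : ℤ) ^ M := by
      rw [← pow_add, ← pow_add]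
      have h₁ := hNe i
      have h₂ := hNM i
      congr 1
      omega
    change ((2 : ℤ) ^ e i) • (s i • θN P) = 0
    by_cases h : ν i = 1
    · have hs : s i = -(2 : ℤ) ^ (M - Nv i) := if_pos h
      rw [hs, smul_smul, mul_neg, hpow, neg_smul, mul_zsmul, hkill, smul_zero, neg_zero]
    · have hs : s i = (2 : ℤ) ^ (M - Nv i) := if_neg h
      rw [hs, smul_smul, hpow, mul_zsmul, hkill, smul_zero]
  -- McCallum's (2) at `2`: a `ρ` realising the `v_i`
  obtain ⟨ρ, hρ, hρe⟩ := exists_h1Eval_eq_of_indep_twoPow hc hωK (W.baseChange K) hCB hM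
    xs e he hind v hvkill
  refine ⟨ρ, hρ, fun m hm i => ?_⟩
  have hρm : ρ * m ∈ torsionFixing (W.baseChange K) ((2 ^ M : ℕ) : ℤ) := mul_mem hρ hm.1
  -- `[x_i, (ρm)^τ (ρm)] = ν_i τ v_i + v_i`
  have hval : h1Eval (W.baseChange K) ((2 ^ M : ℕ) : ℤ) (xs i)
      (hτ.conjGalCMH (ρ * m) * (ρ * m)) = ν i • hτ.torsionMap W ((2 ^ M : ℕ) : ℤ) (v i) + v i := by
    rw [h1Eval_mul _ _ _ (hτ.conjGalCMH_mem_torsionFixing W hinv _ hρm),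
      hτ.h1Eval_conjGalCMH_of_eigen W hinv _ (hν i) (hxs i) hρm, h1Eval_mul _ _ _ hρ, hρe i,
      hm.2 i, add_zero]
  -- … which is `2^{M-N_i}` times the generator of the `ν_i`-eigenline
  have h2 := EisensteinTorsion.apply_apply_eq θN hθN P
  have hgen : ∀ {G : geomTorsion (W.baseChange K) ((2 ^ M : ℕ) : ℤ)}, addOrderOf G = 2 ^ M →
      ((2 : ℤ) ^ Nv i) • (((2 : ℤ) ^ (M - Nv i)) • G) = 0 ∧
      (Nv i ≠ 0 → ((2 : ℤ) ^ (Nv i - 1)) • (((2 : ℤ) ^ (M - Nv i)) • G) ≠ 0) := by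
    intro G hG
    constructor
    · rw [smul_smul, ← pow_add, Nat.add_sub_cancel' (hNM i)]
      have := addOrderOf_nsmul_eq_zero G
      rw [hG] at this
      exact_mod_cast this
    · intro hN h0
      rw [smul_smul, ← pow_add] at h0
      have hlt : Nv i - 1 + (M - Nv i) < M := by have := hNM i; omega
      have hne := nsmul_ne_zero_of_lt_addOrderOf (x := G)
        (pow_ne_zero (Nv i - 1 + (M - Nv i)) two_ne_zero)
        (by rw [hG]; exact Nat.pow_lt_pow_right (by norm_num) hlt)
      exact hne (by exact_mod_cast h0)
  rw [hval]
  rcases hν i with h | h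
  · have hs : s i = -(2 : ℤ) ^ (M - Nv i) := if_pos h
    have hw : ν i • hτ.torsionMap W ((2 ^ M : ℕ) : ℤ) (v i) + v i = ((2 : ℤ) ^ (M - Nv i)) • P := by
      change ν i • hτ.torsionMap W ((2 ^ M : ℕ) : ℤ) (s i • θN P) + s i • θN P = _
      rw [h, one_smul, hs, map_zsmul, hτθ, hτP, h2]
      simp only [smul_sub, smul_neg, neg_smul]
      module
    rw [hw]
    exact hgen hP
  · have h' : ¬ ν i = 1 := by rw [h]; norm_num
    have hs : s i = (2 : ℤ) ^ (M - Nv i) := if_neg h'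
    have hw : ν i • hτ.torsionMap W ((2 ^ M : ℕ) : ℤ) (v i) + v i =
        ((2 : ℤ) ^ (M - Nv i)) • (P + (2 : ℤ) • θN P) := by
      change ν i • hτ.torsionMap W ((2 ^ M : ℕ) : ℤ) (s i • θN P) + s i • θN P = _
      rw [h, hs, map_zsmul, hτθ, hτP, h2]
      simp only [smul_add, smul_sub, smul_neg, neg_smul, one_smul]
      module
    rw [hw]
    exact hgen hQ

end StepB

end Summit.BirchSwinnertonDyer.BirchSwinnertonDyer.Theorems.SylvesterTwoUpper

end
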